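import Literature.NumberTheory.ComplexMultiplication.MainTheoremCMIsogenyFormTransport
import Literature.NumberTheory.ComplexMultiplication.MainTheoremCMIsogenyFormArtinCorrespondent
import Literature.AlgebraicGeometry.Motives.AbelianVarietyConjugateBiproduct
import HarnessLib

/-!
# The isogeny form of the main theorem of complex multiplication for a CM ALGEBRA `F = ∏ᵢ Kᵢ`, by `⨁ᵢ`
# (Deligne 1971, 4.19 for the special pairs of 4.18; Shimura 1998, §18.6–18.8; Milne, Thm. 11.2)

Topic `Literature/NumberTheory/ComplexMultiplication`, namespace `Literature.NumberTheory.ComplexMultiplication`.  Cell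
`hodgecm-mathlib` (D-0151), #60 road item **R60-37b** (lead A-p05, TABLE v1.17; sequel of ★ R60-37 «ORDER REACH», over B-p07's ★ R60-28b
family form and ★ R60-24b `⨁`-conjugation kit): a banked GENERIC leaf toward row I-7 `SiegelS1`.  THEOREMS ONLY (no definition, no named
fact, no instance; net debt 0): `[HasFiniteBiproducts (AbelianVariety ℂ)]` is an instance BINDER, exactly as in ★ R60-24b (the consumer's ★
`AbelianVariety.hasFiniteBiproducts_inst` of `ComplexMultiplication/PrincipalModelOfCMOrder` discharges it; a `Prop`-class, so all witnesses
agree), and the main theorem of complex multiplication enters only as the HYPOTHESIS `(h186 : shimura1998_thm18_6)` of §D.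

## Why (the print)

[Deligne1971TravauxShimura] 4.18–4.19 (pp. 150–151) proves the reciprocity law of the Siegel modular variety at the special pairs `(L = ∏ᵢ Kᵢ, h)`,
`L` a PRODUCT OF CM FIELDS acting on `V` (free of rank one), by the theorem of Shimura–Taniyama for the abelian variety `V_ℝ/Λ` with
complex multiplication by (an order of) the CM ALGEBRA `L`: «`A` est isogène à un produit» — [Shimura1998] §18.7–18.8 (pp. 129–131; Thm. 18.6 is
stated for a CM FIELD and a PRINCIPAL structure) and [Milne2005ShimuraVarieties] Thm. 11.2 p. 108 (ANY `(A, i : E → End⁰ A)` of CM type, `E` a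
CM algebra: «there is a unique `E`-linear isogeny `α : A → σA` such that `α(N_Φ(s)·x) = σx` for all `x ∈ V_f A`»).  In the tree: per factor
the isogeny form is ★ R60-28/R60-28b (`exists_isIsogeny_conjugate_idele(_family)_of_…`), the reach of arbitrary lattices along isogenies is
★ R60-37, and `σ(⨁ᵢ Aᵢ) ≅ ⨁ᵢ σAᵢ` is ★ R60-24b.  This file ASSEMBLES them: the isogeny form for `⨁ᵢ Aᵢ` with its diagonal `∏ᵢ 𝓞ᵢ`-action and
torsion parametrised by `u ↦ ∏ᵢ ιᵢ(rᵢ(uᵢ))`, `u ∈ ∏ᵢ Kᵢ`, and its transport to every `B` isogenous to `⨁ᵢ Aᵢ` — e.g. the algebraic model of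
the marked torus `(V_ℝ, J)/Λ_a` of a CM point `[J, a]` whose lattice `Λ_a = ℚ^{2g} ∩ a·ẑ^{2g}` is not `∏𝓞ᵢ`-stable (A-p01's ★ R60-40
`IsCMAlgTorusRat.exists_isIsogeny_sigmaPi_integralBasis_equivariant`: every lattice-general CM torus is `∏Kᵢ`-equivariantly isogenous to the
maximal-order product).

## What is proved

* §A `exists_isIsogeny_conjugate_transport_of_parametrisation` — ★ R60-37's transport for ANY torsion parametrisation `R : U → A(ℂ)` with
  `R(n·w) = R(w)ⁿ` and ANY relation `REL` (output clause at `REL u (n·w)`): the shape a `⨁ᵢ` / `Σᵢψᵢ` consumer needs.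
* §B′ `isIsogeny_biproduct_map_of_forall` — `⨁ᵢ gᵢ` is an isogeny when every `gᵢ` is (any finite index; quasi-inverses with a common exponent
  `N = ∏ nᵢ`, ★ `IsIsogeny.exists_nsmul_inverse_holds`, ★ `isIsogeny_of_comp_eq_of_comp_eq`); the tree's ★ `Milne1999.…isIsogeny_biproduct_map`
  is the `Fin (n+1)`-indexed form.
* §B **`exists_isIsogeny_conjugate_biproduct_of_forall`** — the `⨁ᵢ` ASSEMBLY, idèle-generic: from per-factor isogenies `fᵢ : Aᵢ ⟶ Aᵢ^σ`,
  `ιᵢ`-equivariant, with (18.3a) clauses for idèles `tᵢ`, an isogeny `F : ⨁ᵢ Aᵢ ⟶ (⨁ᵢ Aᵢ)^σ` (`= ⨁ᵢ fᵢ ≫ e⁻¹`, `e` the comparison of ★ R60-24b),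
  equivariant for the diagonal action `x ↦ ⨁ᵢ ιᵢ(xᵢ)` of `∏ᵢ 𝓞ᵢ`, with «`σ(∏ᵢ ιᵢ(rᵢ uᵢ)) = F(∏ᵢ ιᵢ(rᵢ wᵢ))` whenever `tᵢ·(uᵢ mod 𝔞ᵢ) = wᵢ mod tᵢ𝔞ᵢ`
  for all `i`».
* §C **`exists_isIsogeny_conjugate_biproduct_transport`** — §A ∘ §B: the same read on any `B` through an isogeny `ψ : ⨁ᵢ Aᵢ ⟶ B`, per-factor
  idèles `cᵢ⁻¹tᵢ`, `f_B` commuting with every endomorphism of `B` through which the diagonal action descends (CM by an ORDER of `∏ᵢ Kᵢ`).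
* §D HEAD **`exists_isIsogeny_conjugate_idele_biproduct_of_isArtinCorrespondent`** — ASSUMING `shimura1998_thm18_6`, over ★ R60-28b's family
  form (Milne's sign, `E ⊇ E*(Φᵢ)` for all `i`, `art_E(t) = σ`): for every isogeny `ψ : ⨁ᵢ Aᵢ ⟶ B`, `σ` acts on `B(ℂ)_tors = ψ(∏ᵢ ιᵢ rᵢ(∏ Kᵢ))` as
  the componentwise idèle multiplication `γᵢ⁻¹N_{Φᵢ}(t)` followed by ONE isogeny `f_B : B ⟶ B^σ` commuting with the transported `∏ᵢ 𝓞ᵢ`-action —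
  Thm. 11.2 for `(B, ∏ᵢ Kᵢ → End⁰ B)` in the currency of ★ `CMStructure.cmRecipMatrix` (no inversion: Milne's (60)–(62)).

## References
* [Deligne1971TravauxShimura] P. Deligne, *Travaux de Shimura*, Sém. Bourbaki 389 (1971), 4.18–4.19 pp. 150–151.
* [Shimura1998] G. Shimura, *Abelian Varieties with Complex Multiplication and Modular Functions* (1998), §18.6 Thm. 18.6 pp. 124–125 and the first
  part of its proof pp. 125–126; §18.7–18.8 pp. 129–131; §7.1 Prop. 7 p. 47.
* [Milne2005ShimuraVarieties] J. S. Milne, *Introduction to Shimura varieties* (2005), §11 Thm. 11.2 p. 108.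
* [MumfordAV1970] D. Mumford, *Abelian Varieties* (1970), §19 (products, `Hom(⊕ Aᵢ, B)`, quasi-inverse Remark p. 169).
-/

noncomputable section

open scoped Classical nonZeroDivisors NumberField
open CategoryTheory CategoryTheory.Limits NumberField

namespace Literature.NumberTheory.ComplexMultiplication

open Literature.AlgebraicGeometry.Motives (CMType AbelianVariety AlgPoints specOver)
open Literature.AlgebraicGeometry.Motives.AbelianVariety
open Literature.NumberTheory.GaloisRepresentations (ideleGroup)
open Literature.NumberTheory.NumberFields.IdeleAction
open Literature.NumberTheory.AdelicBaseChange (ideleRelNorm)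
open Literature.AlgebraicGeometry.ShimuraVarieties.UnitaryCanonicalModel (IsArtinCorrespondent)
open IsDedekindDomain

namespace CMTypeUniformization

/-! ## §0 Bookkeeping on points -/

section Points

/-- Composition of homomorphisms of abelian varieties read on points, `(f ≫ g)(P) = g(f(P))`.
[cite: MumfordAV1970, §19 (homomorphisms), p. 169] -/
private theorem map_comp_hom' {k : Type} [Field k] {A B C : AbelianVariety k} {L : Type} [Field L] [Algebra k L]
    (f : A ⟶ B) (g : B ⟶ C) (P : A.Points L) :
    AlgPoints.map (f ≫ g).hom.hom.hom P = AlgPoints.map g.hom.hom.hom (AlgPoints.map f.hom.hom.hom P) :=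
  AlgPoints.map_comp_apply f.hom.hom.hom g.hom.hom.hom P

/-- A quasi-inverse pair read on points, `ψχ = [n] ⇒ χ(ψ(P)) = Pⁿ`. [cite: MumfordAV1970, §19 Remark, p. 169] -/
private theorem map_map_eq_pow_of_comp_eq_nsmul' {k : Type} [Field k] {A B : AbelianVariety k} {L : Type} [Field L]
    [Algebra k L] {ψ : A ⟶ B} {χ : B ⟶ A} {n : ℕ} (h : ψ ≫ χ = n • 𝟙 A) (P : A.Points L) :
    AlgPoints.map χ.hom.hom.hom (AlgPoints.map ψ.hom.hom.hom P) = P ^ n := by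
  rw [← map_comp_hom', h, ← natCast_zsmul, map_zsmul_id_apply, zpow_natCast]

/-- Homomorphisms are multiplicative on points: `f(∏ᵢ Pᵢ) = ∏ᵢ f(Pᵢ)` (the group law of `B(ℂ)` is induced by that of `B`, and `f` is a
homomorphism of group schemes; Mathlib `IsMonHom.monoidHom`). [cite: MumfordAV1970, §4 (Cor. 1 of the rigidity lemma); §19] -/
private theorem map_prod_points {A B : AbelianVariety ℂ} (f : A ⟶ B) {I : Type} (s : Finset I) (P : I → A.Points ℂ) :
    AlgPoints.map f.hom.hom.hom (∏ i ∈ s, P i) = ∏ i ∈ s, AlgPoints.map f.hom.hom.hom (P i) :=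
  map_prod (IsMonHom.monoidHom f.hom.hom.hom (specOver ℂ ℂ)) P s

/-- `f(Pⁿ) = f(P)ⁿ` on points. [cite: MumfordAV1970, §4 (Cor. 1 of the rigidity lemma)] -/
private theorem map_pow_points {A B : AbelianVariety ℂ} (f : A ⟶ B) (P : A.Points ℂ) (n : ℕ) :
    AlgPoints.map f.hom.hom.hom (P ^ n) = AlgPoints.map f.hom.hom.hom P ^ n :=
  map_pow (IsMonHom.monoidHom f.hom.hom.hom (specOver ℂ ℂ)) P n

end Points

/-! ## §A The transport for an ARBITRARY torsion parametrisation -/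

section Parametrised

/-- **★ R60-37's TRANSPORT, parametrisation-generic form** (for the CM-ALGEBRA case, where the source is `⨁ᵢ Aᵢ` with torsion parametrised by
`R(u) = ∏ᵢ ιᵢ(rᵢ(uᵢ))`, `u ∈ ∏ᵢ Kᵢ`, and the (18.3a) relation is componentwise — or for a `Σᵢ ψᵢ`-shaped consumer).  Let `A`, `B` be complex
abelian varieties, `σ ∈ Aut(ℂ)`, `R : U → A(ℂ)` ANY map from an additive monoid with `R(n·w) = R(w)ⁿ`, `REL` ANY relation on `U`,
`f : A ⟶ A^σ` an isogeny with «`σ(R u) = f(R w)` whenever `REL u w`», and `ψ : A ⟶ B` an isogeny.  Then there are an isogeny `f_B : B ⟶ B^σ` and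
`n ≥ 1` (the exponent of a quasi-inverse `χ`, `ψχ = [n] = χψ`, ★ `IsIsogeny.exists_nsmul_inverse_holds`; `f_B := χ ≫ f ≫ ψ^σ`) with (ii) for
all endomorphisms `a` of `A`, `e` of `B`: `a ≫ ψ = ψ ≫ e → a ≫ f = f ≫ a^σ → e ≫ f_B = f_B ≫ e^σ`, and (iii) «`σ(ψ(R u)) = f_B(ψ(R w))` whenever
`REL u (n·w)`» — the consumer rescales its relation (for idèles: ★ `ideleMulEquiv_mk_eq_mk_mul_of_unitEmbedding_inv_mul`, componentwise).
Same proof as ★ `exists_isIsogeny_conjugate_idele_transport` ([Shimura1998] pp. 125–126 through an isogeny `λ`; Thm. 11.2's isogeny-invariance).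
[cite: Shimura1998, §18.6 proof of Thm. 18.6, pp. 125–126; §7.1 Prop. 7, p. 47] [cite: Deligne1971TravauxShimura, 4.19 p. 151]
[cite: Milne2005ShimuraVarieties, §11 Thm. 11.2, p. 108] [cite: MumfordAV1970, §19 Remark, p. 169] -/
theorem exists_isIsogeny_conjugate_transport_of_parametrisation {A B : AbelianVariety ℂ} (σ : ℂ ≃+* ℂ) {U : Type*} [AddMonoid U]
    (R : U → A.Points ℂ) (hR : ∀ (n : ℕ) (w : U), R (n • w) = R w ^ n) (REL : U → U → Prop)
    {f : A ⟶ A.conjugate σ} (hfi : IsIsogeny f) (hf : ∀ u w : U, REL u w → A.conjPoints σ (R u) = AlgPoints.map f.hom.hom.hom (R w))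
    {ψ : A ⟶ B} (hψ : IsIsogeny ψ) :
    ∃ (fB : B ⟶ B.conjugate σ) (n : ℕ), 0 < n ∧ IsIsogeny fB ∧
      (∀ (a : End A) (e : End B), a ≫ ψ = ψ ≫ e → a ≫ f = f ≫ (A.endConjugate σ) a →
        e ≫ fB = fB ≫ (B.endConjugate σ) e) ∧
      ∀ u w : U, REL u (n • w) →
        B.conjPoints σ (AlgPoints.map ψ.hom.hom.hom (R u)) =
          AlgPoints.map fB.hom.hom.hom (AlgPoints.map ψ.hom.hom.hom (R w)) := by
  obtain ⟨χ, n, hn, hψχ, hχψ⟩ := IsIsogeny.exists_nsmul_inverse_holds hψ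
  have hnC : (n : ℂ) ≠ 0 := Nat.cast_ne_zero.2 hn.ne'
  have hχ : IsIsogeny χ :=
    isIsogeny_of_comp_eq_of_comp_eq (isIsogeny_nsmul_id_of_cast_ne_zero A n hnC)
      (isIsogeny_nsmul_id_of_cast_ne_zero B n hnC) hψχ hχψ
  have hψσ : IsIsogeny (Hom.conjugate σ ψ) :=
    hψ.baseChange (Literature.AlgebraicGeometry.Motives.AlongHom ℂ σ.toRingHom)
  refine ⟨χ ≫ f ≫ Hom.conjugate σ ψ, n, hn, isIsogeny_comp hχ (isIsogeny_comp hfi hψσ), ?_, ?_⟩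
  · intro a e hae haf
    set ia : A ⟶ A := a with hia
    set eB : B ⟶ B := e with heB
    change ia ≫ ψ = ψ ≫ eB at hae
    change ia ≫ f = f ≫ Hom.conjugate σ ia at haf
    change eB ≫ χ ≫ f ≫ Hom.conjugate σ ψ = (χ ≫ f ≫ Hom.conjugate σ ψ) ≫ Hom.conjugate σ eB
    have heχ : eB ≫ χ = χ ≫ ia := by
      refine hψ.cancel_left ?_
      calc ψ ≫ eB ≫ χ = (ia ≫ ψ) ≫ χ := by rw [← Category.assoc, ← hae]
        _ = ia ≫ (n • 𝟙 A) := by rw [Category.assoc, hψχ]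
        _ = (n • 𝟙 A) ≫ ia := by
            rw [Preadditive.comp_nsmul, Preadditive.nsmul_comp, Category.comp_id, Category.id_comp]
        _ = ψ ≫ χ ≫ ia := by rw [← Category.assoc, hψχ]
    calc eB ≫ χ ≫ f ≫ Hom.conjugate σ ψ
        = (eB ≫ χ) ≫ f ≫ Hom.conjugate σ ψ := by rw [Category.assoc]
      _ = (χ ≫ ia) ≫ f ≫ Hom.conjugate σ ψ := by rw [heχ]
      _ = χ ≫ (ia ≫ f) ≫ Hom.conjugate σ ψ := by simp only [Category.assoc]
      _ = χ ≫ (f ≫ Hom.conjugate σ ia) ≫ Hom.conjugate σ ψ := by rw [haf]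
      _ = χ ≫ f ≫ Hom.conjugate σ (ia ≫ ψ) := by rw [Hom.conjugate_comp]; simp only [Category.assoc]
      _ = χ ≫ f ≫ Hom.conjugate σ (ψ ≫ eB) := by rw [hae]
      _ = (χ ≫ f ≫ Hom.conjugate σ ψ) ≫ Hom.conjugate σ eB := by
          rw [Hom.conjugate_comp]; simp only [Category.assoc]
  · intro u w huw
    have hRn : R (n • w) = AlgPoints.map χ.hom.hom.hom (AlgPoints.map ψ.hom.hom.hom (R w)) := by
      rw [map_map_eq_pow_of_comp_eq_nsmul' hψχ, hR]
    rw [conjPoints_map, hf u (n • w) huw, hRn, map_comp_hom', map_comp_hom']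

end Parametrised

/-! ## §B′ A componentwise isogeny of finite biproducts is an isogeny -/

section BiproductMap

variable [HasFiniteBiproducts (AbelianVariety ℂ)] {I : Type} [Fintype I]

/-- `⨁ᵢ fᵢ ≫ ⨁ᵢ gᵢ = ⨁ᵢ (fᵢ ≫ gᵢ)` (componentwise composition). [cite: MumfordAV1970, §19 (Hom(⊕ Aᵢ, ⊕ Bᵢ))] -/
private theorem biproduct_map_comp_map {A B C : I → AbelianVariety ℂ} (f : ∀ i, A i ⟶ B i) (g : ∀ i, B i ⟶ C i) :
    biproduct.map f ≫ biproduct.map g = biproduct.map fun i => f i ≫ g i :=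
  biproduct.hom_ext _ _ fun j => by
    rw [Category.assoc, biproduct.map_π, biproduct.map_π_assoc, biproduct.map_π]

/-- `⨁ᵢ [N]_{Aᵢ} = [N]_{⨁ᵢ Aᵢ}`. [cite: MumfordAV1970, §19 (Hom(⊕ Aᵢ, ⊕ Bᵢ))] -/
private theorem biproduct_map_nsmul_id (A : I → AbelianVariety ℂ) (N : ℕ) :
    biproduct.map (fun i => (N • 𝟙 (A i) : A i ⟶ A i)) = N • 𝟙 (⨁ A) := by
  refine biproduct.hom_ext _ _ fun j => ?_
  rw [biproduct.map_π, Preadditive.comp_nsmul, Category.comp_id, Preadditive.nsmul_comp, Category.id_comp]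

/-- **`⨁ᵢ gᵢ : ⨁ᵢ Aᵢ ⟶ ⨁ᵢ Bᵢ` is an isogeny when every `gᵢ` is** (any finite index type).  Proof: quasi-inverses `hᵢ` with `gᵢhᵢ = [nᵢ] = hᵢgᵢ`
(★ `IsIsogeny.exists_nsmul_inverse_holds`); with `N = ∏ᵢ nᵢ` and `hᵢ′ = (N/nᵢ)·hᵢ` the componentwise `⨁ᵢ hᵢ′` is a two-sided quasi-inverse of
`⨁ᵢ gᵢ` with exponent `N`, so `⨁ᵢ gᵢ` is an isogeny (★ `isIsogeny_of_comp_eq_of_comp_eq`, `[N]` an isogeny in characteristic `0`).  (The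
`Fin (n+1)`-indexed form by induction on binary products is ★ `Milne1999.…isIsogeny_biproduct_map`.)
[cite: MumfordAV1970, §19 (products of isogenies; Remark p. 169)] [cite: Milne1986AbelianVarieties, §12 p. 122] -/
theorem isIsogeny_biproduct_map_of_forall {A B : I → AbelianVariety ℂ} {g : ∀ i, A i ⟶ B i} (hg : ∀ i, IsIsogeny (g i)) :
    IsIsogeny (biproduct.map g) := by
  choose h n hn hgh hhg using fun i => IsIsogeny.exists_nsmul_inverse_holds (hg i)
  -- a common exponent `N = ∏ nᵢ`
  set N : ℕ := ∏ i, n i with hN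
  have hNpos : 0 < N := Finset.prod_pos fun i _ => hn i
  have hNC : (N : ℂ) ≠ 0 := Nat.cast_ne_zero.2 hNpos.ne'
  have hdiv : ∀ i, n i ∣ N := fun i => Finset.dvd_prod_of_mem n (Finset.mem_univ i)
  -- `hᵢ′ := (N / nᵢ) • hᵢ`
  have h1 : biproduct.map g ≫ biproduct.map (fun i => (N / n i) • h i) = N • 𝟙 (⨁ A) := by
    rw [biproduct_map_comp_map, ← biproduct_map_nsmul_id]
    congr 1
    funext i
    rw [Preadditive.comp_nsmul, hgh i, smul_smul, Nat.div_mul_cancel (hdiv i)]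
  have h2 : biproduct.map (fun i => (N / n i) • h i) ≫ biproduct.map g = N • 𝟙 (⨁ B) := by
    rw [biproduct_map_comp_map, ← biproduct_map_nsmul_id]
    congr 1
    funext i
    rw [Preadditive.nsmul_comp, hhg i, smul_smul, Nat.div_mul_cancel (hdiv i)]
  exact isIsogeny_of_comp_eq_of_comp_eq (isIsogeny_nsmul_id_of_cast_ne_zero _ N hNC)
    (isIsogeny_nsmul_id_of_cast_ne_zero _ N hNC) h2 h1

end BiproductMap

/-! ## §B The `⨁ᵢ` assembly of per-factor isogeny forms -/

section Assembly

variable [HasFiniteBiproducts (AbelianVariety ℂ)] {I : Type} [Fintype I]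
  {K : I → Type} [∀ i, Field (K i)] [∀ i, NumberField (K i)] {Φ : ∀ i, CMType (K i)}
  {𝔞 : ∀ i, (FractionalIdeal (𝓞 (K i))⁰ (K i))ˣ} {A : I → AbelianVariety ℂ} {ιA : ∀ i, 𝓞 (K i) →+* End (A i)}

/-- **THE `⨁ᵢ` ASSEMBLY (idèle-generic).**  Let `(Aᵢ, ιᵢ, ξᵢ)` be uniformised structures of types `(Kᵢ, Φᵢ, 𝔞ᵢ)` over `ℂ` (`i ∈ I` finite),
`σ ∈ Aut(ℂ)`, `tᵢ` finite idèles of `Kᵢ`, and `fᵢ : Aᵢ ⟶ Aᵢ^σ` isogenies commuting with `ιᵢ` and satisfying «`σ(rᵢ u) = fᵢ(rᵢ w)` whenever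
`tᵢ·(u mod 𝔞ᵢ) = w mod tᵢ𝔞ᵢ`».  Then there is an isogeny `F : ⨁ᵢ Aᵢ ⟶ (⨁ᵢ Aᵢ)^σ` — namely `⨁ᵢ fᵢ` followed by the comparison
`⨁ᵢ Aᵢ^σ ≅ (⨁ᵢ Aᵢ)^σ` of ★ R60-24b — which (a) commutes with the DIAGONAL action `x ↦ ⨁ᵢ ιᵢ(xᵢ)` of `∏ᵢ 𝓞_{Kᵢ}` (`⨁ᵢ ιᵢ(xᵢ) ≫ F = F ≫ (⨁ᵢ ιᵢ(xᵢ))^σ`),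
and (b) satisfies, on the torsion `(⨁ᵢ Aᵢ)(ℂ)_tors = ∏ᵢ ιᵢ(rᵢ(Kᵢ))` parametrised by `u ↦ ∏ᵢ ιᵢ(rᵢ(uᵢ))`, `u ∈ ∏ᵢ Kᵢ`:
**`σ(∏ᵢ ιᵢ(rᵢ uᵢ)) = F(∏ᵢ ιᵢ(rᵢ wᵢ))` whenever `tᵢ·(uᵢ mod 𝔞ᵢ) = wᵢ mod tᵢ𝔞ᵢ` for all `i`** — the isogeny form for the CM ALGEBRA
`∏ᵢ Kᵢ` acting on `⨁ᵢ Aᵢ` ([Shimura1998] §18.7 «`A` isogenous to a product»; [Deligne1971TravauxShimura] 4.19 at the pairs of 4.18).  Points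
bookkeeping: `σ` and `F` are homomorphisms (`map_prod`), `(ιᵢ y)^σ = ιᵢ^σ(y^σ)` (★ `conjPoints_map`), `ιᵢ ≫ ⨁fⱼ = fᵢ ≫ ιᵢ` (`biproduct.ι_map`) and
`ιᵢ ≫ e⁻¹ = ιᵢ^σ` (★ R60-24b `exists_iso_conjugate_biproduct`).
[cite: Shimura1998, §18.6 Thm. 18.6 (2), p. 125; §18.7, pp. 129–130] [cite: Deligne1971TravauxShimura, 4.18–4.19 pp. 150–151]
[cite: Milne2005ShimuraVarieties, §11 Thm. 11.2, p. 108] [cite: MumfordAV1970, §19] -/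
theorem exists_isIsogeny_conjugate_biproduct_of_forall (ξ : ∀ i, CMTypeUniformization (Φ i) (𝔞 i) (A i) (ιA i))
    (σ : ℂ ≃+* ℂ) (t : ∀ i, (FiniteAdeleRing (𝓞 (K i)) (K i))ˣ) {f : ∀ i, A i ⟶ (A i).conjugate σ}
    (hfi : ∀ i, IsIsogeny (f i)) (hfι : ∀ i (a : 𝓞 (K i)), ιA i a ≫ f i = f i ≫ ((A i).endConjugate σ) (ιA i a))
    (hf : ∀ i (u w : K i), ideleMulEquiv (t i) (𝔞 i : FractionalIdeal (𝓞 (K i))⁰ (K i)) (𝔞 i).ne_zero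
      (Submodule.Quotient.mk u) = Submodule.Quotient.mk w →
      (A i).conjPoints σ ((ξ i).r u) = AlgPoints.map (f i).hom.hom.hom ((ξ i).r w)) :
    ∃ F : (⨁ A) ⟶ (⨁ A).conjugate σ, IsIsogeny F ∧
      (∀ x : ∀ i, 𝓞 (K i),
        biproduct.map (fun i => (ιA i (x i) : A i ⟶ A i)) ≫ F =
          F ≫ ((⨁ A).endConjugate σ) (biproduct.map fun i => (ιA i (x i) : A i ⟶ A i))) ∧
      ∀ u w : ∀ i, K i,
        (∀ i, ideleMulEquiv (t i) (𝔞 i : FractionalIdeal (𝓞 (K i))⁰ (K i)) (𝔞 i).ne_zero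
          (Submodule.Quotient.mk (u i)) = Submodule.Quotient.mk (w i)) →
        (⨁ A).conjPoints σ (∏ i, AlgPoints.map (biproduct.ι A i).hom.hom.hom ((ξ i).r (u i))) =
          AlgPoints.map F.hom.hom.hom (∏ i, AlgPoints.map (biproduct.ι A i).hom.hom.hom ((ξ i).r (w i))) := by
  obtain ⟨e, heπ, heι, hιe, -⟩ := exists_iso_conjugate_biproduct σ A
  refine ⟨biproduct.map f ≫ e.inv, ?_, ?_, ?_⟩
  · -- isogeny: `⨁ fᵢ` is (§B′) and `e⁻¹` is an isomorphism
    exact isIsogeny_comp (isIsogeny_biproduct_map_of_forall hfi) (isIsogeny_hom_of_iso e.symm)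
  · -- (a) diagonal equivariance
    intro x
    set gx : ∀ i, A i ⟶ A i := fun i => (ιA i (x i) : A i ⟶ A i) with hgx
    change biproduct.map gx ≫ biproduct.map f ≫ e.inv =
      (biproduct.map f ≫ e.inv) ≫ Hom.conjugate σ (biproduct.map gx)
    have hcomm : ∀ i, gx i ≫ f i = f i ≫ Hom.conjugate σ (gx i) := fun i => hfι i (x i)
    -- `⨁(σgᵢ) ≫ e⁻¹ = e⁻¹ ≫ σ(⨁ gᵢ)` from R60-24b's `e ≫ ⨁(σgᵢ) = σ(⨁gᵢ) ≫ e`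
    have hmap : biproduct.map (fun i => Hom.conjugate σ (gx i)) ≫ e.inv = e.inv ≫ Hom.conjugate σ (biproduct.map gx) := by
      rw [Iso.comp_inv_eq, Category.assoc, Iso.eq_inv_comp]
      exact conjugate_biproduct_map σ gx e heπ e heπ
    calc biproduct.map gx ≫ biproduct.map f ≫ e.inv
        = biproduct.map (fun i => gx i ≫ f i) ≫ e.inv := by rw [← Category.assoc, biproduct_map_comp_map]
      _ = biproduct.map (fun i => f i ≫ Hom.conjugate σ (gx i)) ≫ e.inv := by
          congr 2; funext i; exact hcomm i
      _ = biproduct.map f ≫ biproduct.map (fun i => Hom.conjugate σ (gx i)) ≫ e.inv := by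
          rw [← Category.assoc, biproduct_map_comp_map]
      _ = (biproduct.map f ≫ e.inv) ≫ Hom.conjugate σ (biproduct.map gx) := by rw [hmap, Category.assoc]
  · -- (b) the clause on `∏ᵢ ιᵢ(rᵢ uᵢ)`
    intro u w huw
    rw [map_prod, map_prod_points]
    refine Finset.prod_congr rfl fun i _ => ?_
    -- `σ(ιᵢ(rᵢ uᵢ)) = ιᵢ^σ(σ(rᵢ uᵢ)) = ιᵢ^σ(fᵢ(rᵢ wᵢ))` and `ιᵢ ≫ ⨁f ≫ e⁻¹ = fᵢ ≫ ιᵢ^σ`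
    rw [conjPoints_map, hf i (u i) (w i) (huw i), ← map_comp_hom', ← map_comp_hom']
    congr 2
    rw [← Category.assoc, biproduct.ι_map, Category.assoc, heι]

end Assembly

/-! ## §C The assembly transported along an isogeny `ψ : ⨁ᵢ Aᵢ ⟶ B` -/

section AssemblyTransport

variable [HasFiniteBiproducts (AbelianVariety ℂ)] {I : Type} [Fintype I]
  {K : I → Type} [∀ i, Field (K i)] [∀ i, NumberField (K i)] {Φ : ∀ i, CMType (K i)}
  {𝔞 : ∀ i, (FractionalIdeal (𝓞 (K i))⁰ (K i))ˣ} {A : I → AbelianVariety ℂ} {ιA : ∀ i, 𝓞 (K i) →+* End (A i)}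

/-- **The `⨁ᵢ` isogeny form transported to any `B` isogenous to `⨁ᵢ Aᵢ`** (CM by an ORDER of the algebra `∏ᵢ Kᵢ`, e.g. the marked torus
`(V_ℝ, J)/Λ_a` of a CM point with `Λ_a` not `∏𝓞ᵢ`-stable): under the hypotheses of `exists_isIsogeny_conjugate_biproduct_of_forall` and for
an isogeny `ψ : ⨁ᵢ Aᵢ ⟶ B`, there are an isogeny `f_B : B ⟶ B^σ` and `c ∈ ∏ᵢ Kᵢ^×` such that (a) `f_B` commutes with every endomorphism `e` of
`B` through which the diagonal action of some `x ∈ ∏ᵢ 𝓞ᵢ` descends (`⨁ᵢιᵢ(xᵢ) ≫ ψ = ψ ≫ e ⇒ e ≫ f_B = f_B ≫ e^σ`), and (b) on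
`B(ℂ)_tors = ψ(∏ᵢ ιᵢ rᵢ(∏Kᵢ))`: **`σ(ψ(∏ᵢ ιᵢ(rᵢ uᵢ))) = f_B(ψ(∏ᵢ ιᵢ(rᵢ wᵢ)))` whenever `(cᵢ⁻¹tᵢ)·(uᵢ mod 𝔞ᵢ) = wᵢ mod cᵢ⁻¹tᵢ𝔞ᵢ` for all `i`**.
§A at `R(u) = ∏ᵢ ιᵢ(rᵢ uᵢ)` (`R(n·w) = R(w)ⁿ`: `rᵢ(n wᵢ) = rᵢ(wᵢ)ⁿ`, `ιᵢ`, `∏` multiplicative) and the componentwise relation, then §0 of ★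
R60-37 per factor (`cᵢ = n`).
[cite: Shimura1998, §18.6 proof of Thm. 18.6, pp. 125–126; §18.7, pp. 129–130; §7.1 Prop. 7, p. 47] [cite: Deligne1971TravauxShimura, 4.19 p. 151]
[cite: Milne2005ShimuraVarieties, §11 Thm. 11.2, p. 108] -/
theorem exists_isIsogeny_conjugate_biproduct_transport (ξ : ∀ i, CMTypeUniformization (Φ i) (𝔞 i) (A i) (ιA i))
    (σ : ℂ ≃+* ℂ) (t : ∀ i, (FiniteAdeleRing (𝓞 (K i)) (K i))ˣ) {f : ∀ i, A i ⟶ (A i).conjugate σ}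
    (hfi : ∀ i, IsIsogeny (f i)) (hfι : ∀ i (a : 𝓞 (K i)), ιA i a ≫ f i = f i ≫ ((A i).endConjugate σ) (ιA i a))
    (hf : ∀ i (u w : K i), ideleMulEquiv (t i) (𝔞 i : FractionalIdeal (𝓞 (K i))⁰ (K i)) (𝔞 i).ne_zero
      (Submodule.Quotient.mk u) = Submodule.Quotient.mk w →
      (A i).conjPoints σ ((ξ i).r u) = AlgPoints.map (f i).hom.hom.hom ((ξ i).r w))
    {B : AbelianVariety ℂ} {ψ : (⨁ A) ⟶ B} (hψ : IsIsogeny ψ) :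
    ∃ (fB : B ⟶ B.conjugate σ) (c : ∀ i, (K i)ˣ), IsIsogeny fB ∧
      (∀ (x : ∀ i, 𝓞 (K i)) (e : End B),
        biproduct.map (fun i => (ιA i (x i) : A i ⟶ A i)) ≫ ψ = ψ ≫ e → e ≫ fB = fB ≫ (B.endConjugate σ) e) ∧
      ∀ u w : ∀ i, K i,
        (∀ i, ideleMulEquiv (FiniteAdeleRing.unitEmbedding (𝓞 (K i)) (K i) (c i)⁻¹ * t i)
            (𝔞 i : FractionalIdeal (𝓞 (K i))⁰ (K i)) (𝔞 i).ne_zero (Submodule.Quotient.mk (u i)) =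
          Submodule.Quotient.mk (w i)) →
        B.conjPoints σ (AlgPoints.map ψ.hom.hom.hom (∏ i, AlgPoints.map (biproduct.ι A i).hom.hom.hom ((ξ i).r (u i)))) =
          AlgPoints.map fB.hom.hom.hom
            (AlgPoints.map ψ.hom.hom.hom (∏ i, AlgPoints.map (biproduct.ι A i).hom.hom.hom ((ξ i).r (w i)))) := by
  obtain ⟨F, hFi, hFι, hF⟩ := exists_isIsogeny_conjugate_biproduct_of_forall ξ σ t hfi hfι hf
  -- §A at the product parametrisation
  set R : (∀ i, K i) → (⨁ A).Points ℂ := fun u => ∏ i, AlgPoints.map (biproduct.ι A i).hom.hom.hom ((ξ i).r (u i))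
    with hRdef
  have hR : ∀ (n : ℕ) (w : ∀ i, K i), R (n • w) = R w ^ n := by
    intro n w
    simp only [hRdef]
    rw [← Finset.prod_pow]
    refine Finset.prod_congr rfl fun i _ => ?_
    rw [← map_pow_points, Pi.smul_apply, nsmul_eq_mul]
    -- `rᵢ(n wᵢ) = rᵢ(wᵢ)ⁿ`
    congr 1
    unfold CMTypeUniformization.r
    rw [map_mul (CMTypeLattice.cmEmbedding (Φ i)), map_natCast, ← nsmul_eq_mul,
      map_nsmul (CMTypeLattice.coverHom (Φ i) (𝔞 i))]
    exact (ξ i).toFun_nsmul n _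
  obtain ⟨fB, n, hn, hfB, hequiv, hclause⟩ :=
    exists_isIsogeny_conjugate_transport_of_parametrisation σ R hR
      (fun u w => ∀ i, ideleMulEquiv (t i) (𝔞 i : FractionalIdeal (𝓞 (K i))⁰ (K i)) (𝔞 i).ne_zero
        (Submodule.Quotient.mk (u i)) = Submodule.Quotient.mk (w i)) hFi hF hψ
  have hn0 : ∀ i, ((n : ℕ) : K i) ≠ 0 := fun i => Nat.cast_ne_zero.2 hn.ne'
  refine ⟨fB, fun i => Units.mk0 (n : K i) (hn0 i), hfB, fun x e hxe => hequiv _ e hxe (hFι x), fun u w huw => ?_⟩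
  refine hclause u w fun i => ?_
  have h := ideleMulEquiv_mk_eq_mk_mul_of_unitEmbedding_inv_mul (Units.mk0 (n : K i) (hn0 i)) (t i) (𝔞 i).ne_zero (huw i)
  rwa [Units.val_mk0, ← nsmul_eq_mul] at h

end AssemblyTransport

/-! ## §D The head: Thm. 18.6 in isogeny form for every `B` isogenous to `⨁ᵢ Aᵢ` (Milne's sign, `IsArtinCorrespondent`) -/

section Head

variable [HasFiniteBiproducts (AbelianVariety ℂ)]

/-- **The main theorem of complex multiplication, ISOGENY FORM, for a structure ISOGENOUS TO A PRODUCT `⨁ᵢ Aᵢ` of principal structures — CM by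
an ORDER of the CM ALGEBRA `∏ᵢ Kᵢ`.**  ASSUMING `shimura1998_thm18_6`: let `(Aᵢ, ιᵢ, ξᵢ)` be of types `(Kᵢ, Φᵢ, 𝔞ᵢ)` over `ℂ` (`i ∈ I` finite),
`E ⊆ ℂ` a number field containing every `E*(Φᵢ)`, `σ ∈ Aut(ℂ/E)`, `t` a finite idèle of `E` with `art_E(t) = σ|_{E^{ab}}` (★ `IsArtinCorrespondent`,
Milne's (59)), and `ψ : ⨁ᵢ Aᵢ ⟶ B` an ISOGENY.  Then there are an isogeny `f_B : B ⟶ B^σ` and `γ ∈ ∏ᵢ Kᵢ^×` such that (a) `f_B` commutes with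
every endomorphism of `B` through which the diagonal `∏ᵢ𝓞ᵢ`-action descends, and (b) **`σ(ψ(∏ᵢ ιᵢ(rᵢ uᵢ))) = f_B(ψ(∏ᵢ ιᵢ(rᵢ wᵢ)))` whenever
`(γᵢ⁻¹N_{Φᵢ}(t))·(uᵢ mod 𝔞ᵢ) = wᵢ mod γᵢ⁻¹N_{Φᵢ}(t)𝔞ᵢ` for all `i`** (`N_{Φᵢ}(t)` = ★ `reflexNormFinitePart … (ideleRelNorm … (finiteIdeles E t))`,
the currency of ★ R60-28b / ★ `CMStructure.cmRecipMatrix`, no inversion) — [Milne2005ShimuraVarieties] Thm. 11.2 for `(B, ∏ᵢ Kᵢ → End⁰ B)`,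
[Deligne1971TravauxShimura] 4.19 at the special pairs `(∏ᵢ Kᵢ, h_Φ)` of 4.18.  From ★ R60-28b `exists_isIsogeny_conjugate_idele_family_of_isArtinCorrespondent`
by §C (the quasi-inverse exponent absorbed into `γ`).
[cite: Deligne1971TravauxShimura, 4.18–4.19 pp. 150–151] [cite: Milne2005ShimuraVarieties, §11 Thm. 11.2, p. 108]
[cite: Shimura1998, §18.6 Thm. 18.6 (2), p. 125; §18.7, pp. 129–130] -/
theorem exists_isIsogeny_conjugate_idele_biproduct_of_isArtinCorrespondent (h186 : shimura1998_thm18_6)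
    {I : Type} [Fintype I] (K : I → Type) [∀ i, Field (K i)] [∀ i, NumberField (K i)]
    [∀ i, IsCMField (K i)] (Φ : ∀ i, CMType (K i)) [∀ i, NumberField (traceField (Φ i))]
    (E : IntermediateField ℚ ℂ) [NumberField E] (hE : ∀ i, traceField (Φ i) ≤ E)
    (𝔞 : ∀ i, (FractionalIdeal (𝓞 (K i))⁰ (K i))ˣ) (A : I → AbelianVariety ℂ)
    (ιA : ∀ i, 𝓞 (K i) →+* End (A i)) (ξ : ∀ i, CMTypeUniformization (Φ i) (𝔞 i) (A i) (ιA i))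
    (σ : ℂ ≃ₐ[E] ℂ) (t : (FiniteAdeleRing (𝓞 E) E)ˣ)
    (ht : IsArtinCorrespondent E (algebraMap E ℂ) t σ.toRingEquiv)
    {B : AbelianVariety ℂ} {ψ : (⨁ A) ⟶ B} (hψ : IsIsogeny ψ) :
    letI : ∀ i, Algebra (traceField (Φ i)) E := fun i =>
      (IntermediateField.inclusion (hE i)).toRingHom.toAlgebra
    ∃ (fB : B ⟶ B.conjugate σ.toRingEquiv) (γ : ∀ i, (K i)ˣ), IsIsogeny fB ∧
      (∀ (x : ∀ i, 𝓞 (K i)) (e : End B),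
        biproduct.map (fun i => (ιA i (x i) : A i ⟶ A i)) ≫ ψ = ψ ≫ e →
          e ≫ fB = fB ≫ (B.endConjugate σ.toRingEquiv) e) ∧
      ∀ u w : ∀ i, K i,
        (∀ i, ideleMulEquiv (FiniteAdeleRing.unitEmbedding (𝓞 (K i)) (K i) (γ i)⁻¹ *
              reflexNormFinitePart (K i) (Φ i) (traceField (Φ i))
                (ideleRelNorm (traceField (Φ i)) E (finiteIdeles E t)))
            (𝔞 i : FractionalIdeal (𝓞 (K i))⁰ (K i)) (𝔞 i).ne_zero (Submodule.Quotient.mk (u i)) =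
          Submodule.Quotient.mk (w i)) →
        B.conjPoints σ.toRingEquiv
            (AlgPoints.map ψ.hom.hom.hom (∏ i, AlgPoints.map (biproduct.ι A i).hom.hom.hom ((ξ i).r (u i)))) =
          AlgPoints.map fB.hom.hom.hom
            (AlgPoints.map ψ.hom.hom.hom (∏ i, AlgPoints.map (biproduct.ι A i).hom.hom.hom ((ξ i).r (w i)))) := by
  letI : ∀ i, Algebra (traceField (Φ i)) E := fun i =>
    (IntermediateField.inclusion (hE i)).toRingHom.toAlgebra
  obtain ⟨f, γ, hfi, hfι, hf⟩ :=
    exists_isIsogeny_conjugate_idele_family_of_isArtinCorrespondent h186 K Φ E hE 𝔞 A ιA ξ σ t ht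
  obtain ⟨fB, c, hfB, hequiv, hclause⟩ :=
    exists_isIsogeny_conjugate_biproduct_transport ξ σ.toRingEquiv _ hfi hfι hf hψ
  refine ⟨fB, fun i => γ i * c i, hfB, hequiv, fun u w huw => hclause u w fun i => ?_⟩
  have h := huw i
  rwa [mul_inv_rev, map_mul, mul_assoc] at h

end Head

end CMTypeUniformization

end Literature.NumberTheory.ComplexMultiplication

end
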